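import Mathlib
import HarnessLib
import Summits.HubbardSuperconductivity.HubbardSuperconductivity.Theorems.KLProgrammeKLRegimeTwoPointLimitCooperResummationSingleSlice
import Summits.HubbardSuperconductivity.HubbardSuperconductivity.Theorems.KLProgrammeKLRegimeSplitBundleV10
import Summits.HubbardSuperconductivity.HubbardSuperconductivity.Theorems.KLProgrammeKLRegimeSplitPairLadder

/-!
# Route `KLProgramme` — crux K3, ENGINE child (`KLRegimeEngineV7` stmt-HubbardSuperconductivity-19662 / its gen-3 successor
# `EngineP4 klPredsV10 klWindowC`): the (E2) PAIR-LADDER INSERTION at `1 ≤ n` — the `∃ w N` witness of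
# `PairLadderStepAtV7 / V6 / V5 … n` and the propagation of the engine's remainder through the one-slice resummation map

Cell gate-hubbard-kl, seat hubbard-kl-k3c1-p1 (g2; technique «composed-map remainder propagation», re-pointed to the engine lane by plan g10
STATUS 17:05:39Z (4) / k3c2-p1 17:17:52Z (3)).  The engine stub `stub_engine_step_values` (k3c2-p1's gen-3 skeleton) must produce, at every
scale `1 ≤ n ≤ n_β + 1` and every pair-class total momentum `Qm`, the second conjunct of `PairLadderStepAtV7` (`…SplitBundleV10`; the `1 ≤ n`
conjuncts of V7 and V6 (`…BundleV8`) are the same text, V5's (`…LegStaging`) differs in ONE token, the leg count): nonnegative weights `w` of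
mass `≤ G.bhi`, a matrix `N` with
`(1 + diag w · 𝒞_{n−1}(Qm))·N = 1`, and `‖𝒞_n(Qm)(k,k′) − (𝒞_{n−1}(Qm)·N)(k,k′)‖ ≤ drivePBar + eremBar + thermalBar + legDressBarQ·legSliceCountT`
on the ball.  What the one-scale tree expansion LITERALLY produces is different in two respects: (i) the ladder part of `𝒞_n(Qm)` is the series
`Σ_j 𝒞_{n−1}(−diag z·𝒞_{n−1})^j` over pair-ladder graphs with `j` slice-`n` bubbles, whose weights `z_p = β⁻¹Σ_ν ĝ_n(ν,p)ĝ_n(−ν,Qm−p)` are the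
TRUE slice bubbles — complex-valued in general (real but sign-indefinite at `Qm ≠ 0` for a cutoff even in `ν`), not the nonnegative model
the clause quantifies over; (ii) the remainder is bounded against that series, not against `𝒞_{n−1}·N`.  This file is the bridge, once:

§1 (abstract, any finite carrier; pure linear algebra on top of p457092 `klcrs_single_slice` / `klcrs_single_slice_ladder_hasSum` /
`klcrs_weight_perturbation`): **`klpli_model_weight_transfer`** — for `|C| ≤ m`, true weights `z` and model weights `w ≥ 0` with
`m·Σ|z| ≤ 1/3`, `m·Σ w ≤ 1/3`, and ANY matrix `T` with `HasSum (j ↦ C(−diag z·C)^j) T`: there is `N` with `(1 + diag w·C)·N = 1 = N·(1 + diag w·C)`,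
`|(C N)(s,t)| ≤ (3/2)m`, `|(C N − C)(s,t)| ≤ (3/2)m²Σ w`, and **`|T(s,t) − (C N)(s,t)| ≤ (9/4)·m²·Σ_s|z_s − w_s|`**; the right-inverse form
`klpli_model_weight_transfer_of_rightInverse` (the engine hands `N_z` with `(1 + diag z·C)·N_z = 1` instead of the series); the target form
**`klpli_target_transfer`** (`‖A(s,t) − T(s,t)‖ ≤ ρ(s,t)` on `B × B` ⟹ `‖A(s,t) − (C N)(s,t)‖ ≤ ρ(s,t) + (9/4)m²Σ|z − w|`); and the real
sign-indefinite case `klpli_sum_posPart_le` / `klpli_sum_sub_posPart_eq` (`w = z⁺`: `Σ z⁺ ≤ Σ|z|`, `Σ|z − z⁺| = Σ z⁻`).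
§2 (model, torus carrier): `klpli_pairArray_entry_le` (from the history's split slot `PairArrayAtV2 … j`: `|𝒞_j(Qm)(s,t)| ≤ 2|U| + D·U²`
EVERYWHERE, `D = P.C_W + klLegKappa·Q.CR·P.Klam³`, the array being zero off the ball); **`klpli_pair_witness`** (the `∃ N` half of the clause for an
arbitrary target `A` and remainder `ρ`, under `G.bhi·(2|U| + D·U²) ≤ 1/3`, `Σ w ≤ G.bhi`, `Σ|z| ≤ G.bhi`).
§3 (the named clauses): `klpli_succ_conjunct` (the common `1 ≤ n` conjunct, generic in the leg-count token) and
**`pairLadderStepAtV7_of_ladderSums`** — for `1 ≤ n`, if for every pair-class `Qm` the engine supplies `(z, w, T, e₁)` with `w ≥ 0`, `Σ w ≤ bhi`,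
`Σ|z| ≤ bhi`, the ladder `HasSum`, `‖𝒞_n(Qm)(k,k′) − T(k,k′)‖ ≤ drivePBar G P U (n−1) + e₁ + thermalBar G P U β n + legDressBarQ G P Q U n
(legSliceCountT …)` on the ball, and the ACCOUNTING `e₁ + (9/4)(2|U| + DU²)²·Σ|z − w| ≤ eremBar G P Q U β L (n−1)`, then
`PairLadderStepAtV7 L M G P Q β U μ K n` (gen-3 bundle `klPredsV10`); `pairLadderStepAtV6_of_ladderSums` (`klPredsV8/V9`) and
`pairLadderStepAtV5_of_ladderSums` (`klPredsV7`, count `legSliceCount`) are the same for the earlier bundles.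
Everything is proved; no definitions; nothing about the model is asserted beyond these implications.  0 kit.
-/

noncomputable section

namespace Summit.HubbardSuperconductivity.HubbardSuperconductivity.Theorems.KLRegimeSplit

set_option linter.dupNamespace false -- summit = problem name (single-conjunct summit), D-0017

open Finset Matrix Literature.MathematicalPhysics.QuantumLattice Literature.Probability.LatticeModels
open Summit.HubbardSuperconductivity.HubbardSuperconductivity.Theorems.KLProgrammeCooperResummation

/-! ## §1 Abstract finite-carrier form: propagation of a remainder through the one-slice resummation map -/

section Abstract

variable {S : Type*} [Fintype S] [DecidableEq S] [Nonempty S]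

/-- **Model-weight transfer (right-inverse form).**  `|C| ≤ m`; true weights `z` and model weights `w ≥ 0`, both of small mass against `m`;
`N_z` a right inverse of `1 + diag z·C`.  Then `1 + diag w·C` has a two-sided inverse `N` with `|(C N)(s,t)| ≤ (3/2)m`,
`|(C N − C)(s,t)| ≤ (3/2)m²Σ w`, and the two resummed arrays differ entrywise by `≤ (9/4)·m²·Σ|z − w|`. -/
theorem klpli_model_weight_transfer_of_rightInverse (C : Matrix S S ℂ) {m : ℝ} (hm : 0 ≤ m) (hC : ∀ s t, ‖C s t‖ ≤ m)
    (z : S → ℂ) (w : S → ℝ) (hw : ∀ s, 0 ≤ w s) (hz : m * ∑ s, ‖z s‖ ≤ 1 / 3) (hwm : m * ∑ s, w s ≤ 1 / 3)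
    (Nz : Matrix S S ℂ) (hNz : (1 + Matrix.diagonal z * C) * Nz = 1) :
    ∃ N : Matrix S S ℂ, (1 + Matrix.diagonal (fun s => (w s : ℂ)) * C) * N = 1 ∧
      N * (1 + Matrix.diagonal (fun s => (w s : ℂ)) * C) = 1 ∧
      (∀ s t, ‖(C * N) s t‖ ≤ 3 / 2 * m) ∧
      (∀ s t, ‖(C * N - C) s t‖ ≤ 3 / 2 * m * (m * ∑ s, w s)) ∧
      ∀ s t, ‖(C * Nz) s t - (C * N) s t‖ ≤ 9 / 4 * m ^ 2 * ∑ s, ‖z s - (w s : ℂ)‖ := by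
  -- the true-weight inverses of `klcrs_single_slice`; `Nz` is THE right inverse
  obtain ⟨Nz', N₀z, hNz'1, hNz'2, -, hN₀z2, hpushz, hN₀zn, -, -, -, -⟩ := klcrs_single_slice z hm C hC hz
  have hNzeq : Nz = Nz' := by
    calc Nz = Nz' * (1 + Matrix.diagonal z * C) * Nz := by rw [hNz'2, Matrix.one_mul]
      _ = Nz' * ((1 + Matrix.diagonal z * C) * Nz) := by rw [Matrix.mul_assoc]
      _ = Nz' := by rw [hNz, Matrix.mul_one]
  subst hNzeq
  -- the model-weight inverses
  have hsum : ∑ s, ‖((w s : ℝ) : ℂ)‖ = ∑ s, w s :=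
    sum_congr rfl fun s _ => by rw [Complex.norm_real, Real.norm_eq_abs, abs_of_nonneg (hw s)]
  have hwm' : m * ∑ s, ‖((w s : ℝ) : ℂ)‖ ≤ 1 / 3 := by rw [hsum]; exact hwm
  obtain ⟨Nw, N₀w, hNw1, hNw2, hN₀w1, -, hpushw, hN₀wn, -, hCN, hCNC, -⟩ :=
    klcrs_single_slice (fun s => (w s : ℂ)) hm C hC hwm'
  refine ⟨Nw, hNw1, hNw2, hCN, fun s t => ?_, fun s t => ?_⟩
  · have h := hCNC s t
    rw [hsum] at h
    exact h
  · have h := klcrs_weight_perturbation z (fun s => (w s : ℂ)) hm C hC N₀z N₀w hN₀z2 hN₀w1 hN₀zn hN₀wn s t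
    rw [hpushz, hpushw, ← Matrix.sub_apply]
    exact h

/-- **Model-weight transfer (ladder-series form).**  As `klpli_model_weight_transfer_of_rightInverse`, with the true-weight resummed array given as
ANY matrix `T` summing the ladder series `Σ_j C·(−diag z·C)^j` (the sum over pair-ladder graphs with `j` slice bubbles, however the expansion
produces it; an entrywise `HasSum` in `ℂ` is the same statement by `Pi.hasSum`): `|T(s,t) − (C N)(s,t)| ≤ (9/4)·m²·Σ|z − w|`. -/
theorem klpli_model_weight_transfer (C : Matrix S S ℂ) {m : ℝ} (hm : 0 ≤ m) (hC : ∀ s t, ‖C s t‖ ≤ m)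
    (z : S → ℂ) (w : S → ℝ) (hw : ∀ s, 0 ≤ w s) (hz : m * ∑ s, ‖z s‖ ≤ 1 / 3) (hwm : m * ∑ s, w s ≤ 1 / 3)
    (T : Matrix S S ℂ) (hT : HasSum (fun j : ℕ => C * (-(Matrix.diagonal z * C)) ^ j) T) :
    ∃ N : Matrix S S ℂ, (1 + Matrix.diagonal (fun s => (w s : ℂ)) * C) * N = 1 ∧
      N * (1 + Matrix.diagonal (fun s => (w s : ℂ)) * C) = 1 ∧
      (∀ s t, ‖(C * N) s t‖ ≤ 3 / 2 * m) ∧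
      (∀ s t, ‖(C * N - C) s t‖ ≤ 3 / 2 * m * (m * ∑ s, w s)) ∧
      ∀ s t, ‖T s t - (C * N) s t‖ ≤ 9 / 4 * m ^ 2 * ∑ s, ‖z s - (w s : ℂ)‖ := by
  obtain ⟨Nz, -, hNz1, -, -, -, -, -, -, -, -, -⟩ := klcrs_single_slice z hm C hC hz
  -- `T = C·N_z` by uniqueness of sums
  have hT' : T = C * Nz := hT.unique (klcrs_single_slice_ladder_hasSum z hm C hC hz Nz hNz1).2
  subst hT'
  exact klpli_model_weight_transfer_of_rightInverse C hm hC z w hw hz hwm Nz hNz1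

omit [Nonempty S] in
/-- **Entrywise form of the ladder series.**  An entrywise `HasSum` in `ℂ` of the ladder series is the matrix `HasSum`. -/
theorem klpli_hasSum_of_entrywise (C : Matrix S S ℂ) (z : S → ℂ) (T : Matrix S S ℂ)
    (hT : ∀ s t, HasSum (fun j : ℕ => (C * (-(Matrix.diagonal z * C)) ^ j) s t) (T s t)) :
    HasSum (fun j : ℕ => C * (-(Matrix.diagonal z * C)) ^ j) T :=
  Pi.hasSum.2 fun s => Pi.hasSum.2 fun t => hT s t

/-- **Target transfer.**  If a target array `A` is within `ρ` of the true-weight ladder sum `T` on `B × B`, then it is within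
`ρ + (9/4)·m²·Σ|z − w|` of the model-weight resummed array `C·N` there (and `N` is a two-sided inverse of `1 + diag w·C` with the entry bounds of
`klpli_model_weight_transfer`). -/
theorem klpli_target_transfer (C : Matrix S S ℂ) {m : ℝ} (hm : 0 ≤ m) (hC : ∀ s t, ‖C s t‖ ≤ m)
    (z : S → ℂ) (w : S → ℝ) (hw : ∀ s, 0 ≤ w s) (hz : m * ∑ s, ‖z s‖ ≤ 1 / 3) (hwm : m * ∑ s, w s ≤ 1 / 3)
    (T : Matrix S S ℂ) (hT : HasSum (fun j : ℕ => C * (-(Matrix.diagonal z * C)) ^ j) T)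
    (B : Finset S) (A : S → S → ℂ) (ρ : S → S → ℝ) (hA : ∀ s ∈ B, ∀ t ∈ B, ‖A s t - T s t‖ ≤ ρ s t) :
    ∃ N : Matrix S S ℂ, (1 + Matrix.diagonal (fun s => (w s : ℂ)) * C) * N = 1 ∧
      N * (1 + Matrix.diagonal (fun s => (w s : ℂ)) * C) = 1 ∧
      (∀ s t, ‖(C * N) s t‖ ≤ 3 / 2 * m) ∧
      (∀ s t, ‖(C * N - C) s t‖ ≤ 3 / 2 * m * (m * ∑ s, w s)) ∧
      ∀ s ∈ B, ∀ t ∈ B, ‖A s t - (C * N) s t‖ ≤ ρ s t + 9 / 4 * m ^ 2 * ∑ s, ‖z s - (w s : ℂ)‖ := by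
  obtain ⟨N, hN1, hN2, hCN, hCNC, hTN⟩ := klpli_model_weight_transfer C hm hC z w hw hz hwm T hT
  refine ⟨N, hN1, hN2, hCN, hCNC, fun s hs t ht => ?_⟩
  calc ‖A s t - (C * N) s t‖ = ‖(A s t - T s t) + (T s t - (C * N) s t)‖ := by rw [sub_add_sub_cancel]
    _ ≤ ‖A s t - T s t‖ + ‖T s t - (C * N) s t‖ := norm_add_le _ _
    _ ≤ ρ s t + 9 / 4 * m ^ 2 * ∑ s, ‖z s - (w s : ℂ)‖ := add_le_add (hA s hs t ht) (hTN s t)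

omit [DecidableEq S] [Nonempty S] in
/-- Real sign-indefinite slice weights: the positive part has mass at most the absolute mass. -/
theorem klpli_sum_posPart_le (z : S → ℝ) : ∑ s, max (z s) 0 ≤ ∑ s, |z s| :=
  sum_le_sum fun _ _ => max_le (le_abs_self _) (abs_nonneg _)

omit [DecidableEq S] [Nonempty S] in
/-- Real sign-indefinite slice weights: replacing `z` by its positive part costs exactly the negative mass,
`Σ_s ‖(z_s : ℂ) − ((z_s)⁺ : ℂ)‖ = Σ_s max (−z_s) 0`. -/
theorem klpli_sum_sub_posPart_eq (z : S → ℝ) :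
    ∑ s, ‖((z s : ℝ) : ℂ) - ((max (z s) 0 : ℝ) : ℂ)‖ = ∑ s, max (-z s) 0 := by
  refine sum_congr rfl fun s _ => ?_
  rw [← Complex.ofReal_sub, Complex.norm_real, Real.norm_eq_abs]
  rcases le_total 0 (z s) with h | h
  · rw [max_eq_left h, sub_self, abs_zero, max_eq_right (by linarith)]
  · rw [max_eq_right h, sub_zero, abs_of_nonpos h, max_eq_left (by linarith)]

end Abstract

/-! ## §2 The torus carrier: the `∃ N` half of (E2-v6) from the history's split slot -/

section Model

variable (L M : ℕ) [NeZero L] [NeZero M]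

/-- **Global entry bound of the truncated pair array from the split slot.**  `PairArrayAtV2 … j` (the scale-`j` arrays are a repulsive
constant `u ∈ [0, 2|U|]` up to `D·U²` on the ball, `D = P.C_W + klLegKappa·Q.CR·P.Klam³`) gives `|𝒞_j(Qm)(s,t)| ≤ 2|U| + D·U²` for ALL
`s, t` (the array vanishes off the ball). -/
theorem klpli_pairArray_entry_le {P : SplitConsts} {Q : EngConsts} {β U μ : ℝ} {K : TrigPolyC4v} {j : ℕ}
    (hsplit : PairArrayAtV2 L M P Q β U μ K j) (hD : 0 ≤ P.C_W + klLegKappa * Q.CR * P.Klam ^ 3) (Qm s t : TorusSite 2 L) :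
    ‖klPairArray L M β U μ K j Qm s t‖ ≤ 2 * |U| + (P.C_W + klLegKappa * Q.CR * P.Klam ^ 3) * U ^ 2 := by
  obtain ⟨u, hu0, hu2, hball⟩ := hsplit Qm
  have hδ : 0 ≤ (P.C_W + klLegKappa * Q.CR * P.Klam ^ 3) * U ^ 2 := mul_nonneg hD (sq_nonneg U)
  by_cases hs : s ∈ klBall L μ K
  · by_cases ht : t ∈ klBall L μ K
    · rw [klPairArray_apply_of_mem L M β U μ K j Qm hs ht]
      have h1 := hball s hs t ht
      calc ‖klPairAmplitude L M β U μ K j Qm s t‖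
          = ‖(klPairAmplitude L M β U μ K j Qm s t - (u : ℂ)) + (u : ℂ)‖ := by rw [sub_add_cancel]
        _ ≤ ‖klPairAmplitude L M β U μ K j Qm s t - (u : ℂ)‖ + ‖(u : ℂ)‖ := norm_add_le _ _
        _ ≤ (P.C_W + klLegKappa * Q.CR * P.Klam ^ 3) * U ^ 2 + u := by
            rw [Complex.norm_real, Real.norm_eq_abs, abs_of_nonneg hu0]; linarith
        _ ≤ 2 * |U| + (P.C_W + klLegKappa * Q.CR * P.Klam ^ 3) * U ^ 2 := by linarith
    · have h0 : klPairArray L M β U μ K j Qm s t = 0 := by simp [klPairArray, ht]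
      rw [h0, norm_zero]; positivity
  · rw [klPairArray_apply_of_not_mem L M β U μ K j Qm hs t, norm_zero]; positivity

/-- **The pair-ladder witness.**  From the split slot `PairArrayAtV2 … j` of the history, the smallness `G.bhi·(2|U| + D·U²) ≤ 1/3`
(a `U ≤ U₀(G,P,Q)` line), true slice weights `z` (`Σ|z| ≤ G.bhi`), model weights `w ≥ 0` (`Σ w ≤ G.bhi`), ANY matrix `T` summing the ladder
series of `𝒞_j(Qm)` with the true weights, and a target `A` within `ρ` of `T` on the ball: there is `N` with
`(1 + diag w·𝒞_j(Qm))·N = 1` (two-sided), `|(𝒞_j(Qm)·N)(s,t)| ≤ (3/2)(2|U| + DU²)`, `|(𝒞_j(Qm)·N − 𝒞_j(Qm))(s,t)| ≤ (3/2)(2|U| + DU²)²·Σ w`, and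
`‖A(k,k′) − (𝒞_j(Qm)·N)(k,k′)‖ ≤ ρ(k,k′) + (9/4)(2|U| + DU²)²·Σ|z − w|` on the ball. -/
theorem klpli_pair_witness {G : GeoConsts} {P : SplitConsts} {Q : EngConsts} {β U μ : ℝ} {K : TrigPolyC4v} {j : ℕ}
    (hsplit : PairArrayAtV2 L M P Q β U μ K j) (hD : 0 ≤ P.C_W + klLegKappa * Q.CR * P.Klam ^ 3)
    (hsmall : G.bhi * (2 * |U| + (P.C_W + klLegKappa * Q.CR * P.Klam ^ 3) * U ^ 2) ≤ 1 / 3)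
    (Qm : TorusSite 2 L) (z : TorusSite 2 L → ℂ) (w : TorusSite 2 L → ℝ) (hw : ∀ p, 0 ≤ w p)
    (hwsum : ∑ p, w p ≤ G.bhi) (hzsum : ∑ p, ‖z p‖ ≤ G.bhi) (T : Matrix (TorusSite 2 L) (TorusSite 2 L) ℂ)
    (hT : HasSum (fun i : ℕ => klPairArray L M β U μ K j Qm * (-(Matrix.diagonal z * klPairArray L M β U μ K j Qm)) ^ i) T)
    (A : TorusSite 2 L → TorusSite 2 L → ℂ) (ρ : TorusSite 2 L → TorusSite 2 L → ℝ)
    (hA : ∀ k ∈ klBall L μ K, ∀ k' ∈ klBall L μ K, ‖A k k' - T k k'‖ ≤ ρ k k') :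
    ∃ N : Matrix (TorusSite 2 L) (TorusSite 2 L) ℂ,
      (1 + Matrix.diagonal (fun p => (w p : ℂ)) * klPairArray L M β U μ K j Qm) * N = 1 ∧
      N * (1 + Matrix.diagonal (fun p => (w p : ℂ)) * klPairArray L M β U μ K j Qm) = 1 ∧
      (∀ s t, ‖(klPairArray L M β U μ K j Qm * N) s t‖ ≤
        3 / 2 * (2 * |U| + (P.C_W + klLegKappa * Q.CR * P.Klam ^ 3) * U ^ 2)) ∧
      (∀ s t, ‖(klPairArray L M β U μ K j Qm * N - klPairArray L M β U μ K j Qm) s t‖ ≤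
        3 / 2 * (2 * |U| + (P.C_W + klLegKappa * Q.CR * P.Klam ^ 3) * U ^ 2) *
          ((2 * |U| + (P.C_W + klLegKappa * Q.CR * P.Klam ^ 3) * U ^ 2) * ∑ p, w p)) ∧
      ∀ k ∈ klBall L μ K, ∀ k' ∈ klBall L μ K,
        ‖A k k' - (klPairArray L M β U μ K j Qm * N) k k'‖ ≤
          ρ k k' + 9 / 4 * (2 * |U| + (P.C_W + klLegKappa * Q.CR * P.Klam ^ 3) * U ^ 2) ^ 2 * ∑ p, ‖z p - (w p : ℂ)‖ := by
  set m : ℝ := 2 * |U| + (P.C_W + klLegKappa * Q.CR * P.Klam ^ 3) * U ^ 2 with hm_def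
  have hm : 0 ≤ m := by
    have : 0 ≤ (P.C_W + klLegKappa * Q.CR * P.Klam ^ 3) * U ^ 2 := mul_nonneg hD (sq_nonneg U)
    have : 0 ≤ |U| := abs_nonneg U
    linarith
  have hC : ∀ s t, ‖klPairArray L M β U μ K j Qm s t‖ ≤ m := fun s t => klpli_pairArray_entry_le L M hsplit hD Qm s t
  have hz : m * ∑ p, ‖z p‖ ≤ 1 / 3 :=
    calc m * ∑ p, ‖z p‖ ≤ m * G.bhi := mul_le_mul_of_nonneg_left hzsum hm
      _ = G.bhi * m := mul_comm _ _
      _ ≤ 1 / 3 := hsmall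
  have hwm : m * ∑ p, w p ≤ 1 / 3 :=
    calc m * ∑ p, w p ≤ m * G.bhi := mul_le_mul_of_nonneg_left hwsum hm
      _ = G.bhi * m := mul_comm _ _
      _ ≤ 1 / 3 := hsmall
  exact klpli_target_transfer (klPairArray L M β U μ K j Qm) hm hC z w hw hz hwm T hT (klBall L μ K) A ρ hA

/-! ## §3 The named clauses -/

/-- **The `1 ≤ n` conjunct of (E2), generic in the leg-count token `cnt`** (`legSliceCount L μ K` for V5, `legSliceCountT L β μ K` for V6/V7).
For `1 ≤ n`: the history's split slot `PairArrayAtV2 … (n−1)`, the smallness `G.bhi·(2|U| + D·U²) ≤ 1/3`, and per pair-class `Qm` the engine's data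
`(z, w, T, e₁)` — true slice weights `z` (`Σ|z| ≤ bhi`), model weights `w ≥ 0` (`Σ w ≤ bhi`), a matrix `T` summing the ladder series of `𝒞_{n−1}(Qm)`
with the true weights, `‖𝒞_n(Qm)(k,k′) − T(k,k′)‖ ≤ drivePBar G P U (n−1) + e₁ + thermalBar G P U β n + legDressBarQ G P Q U n (cnt n (k′, Qm−k′, Qm−k, k))`
on the ball, and the accounting `e₁ + (9/4)(2|U| + D·U²)²·Σ|z − w| ≤ eremBar G P Q U β L (n−1)` — give the `∃ w N` statement with the four named
remainders. -/
theorem klpli_succ_conjunct {G : GeoConsts} {P : SplitConsts} {Q : EngConsts} {β U μ : ℝ} {K : TrigPolyC4v} {n : ℕ}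
    (cnt : ℕ → (Fin 4 → TorusSite 2 L) → ℕ)
    (hsplit : PairArrayAtV2 L M P Q β U μ K (n - 1)) (hD : 0 ≤ P.C_W + klLegKappa * Q.CR * P.Klam ^ 3)
    (hsmall : G.bhi * (2 * |U| + (P.C_W + klLegKappa * Q.CR * P.Klam ^ 3) * U ^ 2) ≤ 1 / 3)
    (hsup : ∀ Qm : TorusSite 2 L, IsPairClassAt L Qm n →
      ∃ (z : TorusSite 2 L → ℂ) (w : TorusSite 2 L → ℝ) (T : Matrix (TorusSite 2 L) (TorusSite 2 L) ℂ) (e₁ : ℝ),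
        (∀ p, 0 ≤ w p) ∧ (∑ p, w p ≤ G.bhi) ∧ (∑ p, ‖z p‖ ≤ G.bhi) ∧
        HasSum (fun i : ℕ => klPairArray L M β U μ K (n - 1) Qm *
          (-(Matrix.diagonal z * klPairArray L M β U μ K (n - 1) Qm)) ^ i) T ∧
        e₁ + 9 / 4 * (2 * |U| + (P.C_W + klLegKappa * Q.CR * P.Klam ^ 3) * U ^ 2) ^ 2 * ∑ p, ‖z p - (w p : ℂ)‖ ≤
          eremBar G P Q U β L (n - 1) ∧
        ∀ k ∈ klBall L μ K, ∀ k' ∈ klBall L μ K,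
          ‖klPairAmplitude L M β U μ K n Qm k k' - T k k'‖ ≤
            drivePBar G P U (n - 1) + e₁ + thermalBar G P U β n +
              legDressBarQ G P Q U n (cnt n ![k', Qm - k', Qm - k, k])) :
    ∀ Qm : TorusSite 2 L, IsPairClassAt L Qm n →
      ∃ w : TorusSite 2 L → ℝ, (∀ p, 0 ≤ w p) ∧ (∑ p, w p ≤ G.bhi) ∧
        ∃ N : Matrix (TorusSite 2 L) (TorusSite 2 L) ℂ,
          (1 + Matrix.diagonal (fun p => (w p : ℂ)) * klPairArray L M β U μ K (n - 1) Qm) * N = 1 ∧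
          ∀ k ∈ klBall L μ K, ∀ k' ∈ klBall L μ K,
            ‖klPairAmplitude L M β U μ K n Qm k k' - (klPairArray L M β U μ K (n - 1) Qm * N) k k'‖ ≤
              drivePBar G P U (n - 1) + eremBar G P Q U β L (n - 1) + thermalBar G P U β n +
                legDressBarQ G P Q U n (cnt n ![k', Qm - k', Qm - k, k]) := by
  intro Qm hQm
  obtain ⟨z, w, T, e₁, hw, hwsum, hzsum, hT, hacc, hA⟩ := hsup Qm hQm
  obtain ⟨N, hN1, -, -, -, hAN⟩ :=
    klpli_pair_witness L M hsplit hD hsmall Qm z w hw hwsum hzsum T hT (klPairAmplitude L M β U μ K n Qm)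
      (fun k k' => drivePBar G P U (n - 1) + e₁ + thermalBar G P U β n +
        legDressBarQ G P Q U n (cnt n ![k', Qm - k', Qm - k, k])) hA
  refine ⟨w, hw, hwsum, N, hN1, fun k hk k' hk' => (hAN k hk k' hk').trans ?_⟩
  linarith

/-- **(E2-v7) from the engine's ladder sums** (gen-3 bundle `klPredsV10`, `…SplitBundleV10`).  For `1 ≤ n` the ultraviolet conjunct is vacuous
and the step conjunct is `klpli_succ_conjunct` at the temperature-aware count `legSliceCountT L β μ K`. -/
theorem pairLadderStepAtV7_of_ladderSums {G : GeoConsts} {P : SplitConsts} {Q : EngConsts} {β U μ : ℝ} {K : TrigPolyC4v} {n : ℕ}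
    (hn : 1 ≤ n) (hsplit : PairArrayAtV2 L M P Q β U μ K (n - 1)) (hD : 0 ≤ P.C_W + klLegKappa * Q.CR * P.Klam ^ 3)
    (hsmall : G.bhi * (2 * |U| + (P.C_W + klLegKappa * Q.CR * P.Klam ^ 3) * U ^ 2) ≤ 1 / 3)
    (hsup : ∀ Qm : TorusSite 2 L, IsPairClassAt L Qm n →
      ∃ (z : TorusSite 2 L → ℂ) (w : TorusSite 2 L → ℝ) (T : Matrix (TorusSite 2 L) (TorusSite 2 L) ℂ) (e₁ : ℝ),
        (∀ p, 0 ≤ w p) ∧ (∑ p, w p ≤ G.bhi) ∧ (∑ p, ‖z p‖ ≤ G.bhi) ∧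
        HasSum (fun i : ℕ => klPairArray L M β U μ K (n - 1) Qm *
          (-(Matrix.diagonal z * klPairArray L M β U μ K (n - 1) Qm)) ^ i) T ∧
        e₁ + 9 / 4 * (2 * |U| + (P.C_W + klLegKappa * Q.CR * P.Klam ^ 3) * U ^ 2) ^ 2 * ∑ p, ‖z p - (w p : ℂ)‖ ≤
          eremBar G P Q U β L (n - 1) ∧
        ∀ k ∈ klBall L μ K, ∀ k' ∈ klBall L μ K,
          ‖klPairAmplitude L M β U μ K n Qm k k' - T k k'‖ ≤
            drivePBar G P U (n - 1) + e₁ + thermalBar G P U β n +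
              legDressBarQ G P Q U n (legSliceCountT L β μ K n ![k', Qm - k', Qm - k, k])) :
    PairLadderStepAtV7 L M G P Q β U μ K n :=
  ⟨fun h0 => absurd h0 (by omega), fun _ => klpli_succ_conjunct L M (legSliceCountT L β μ K) hsplit hD hsmall hsup⟩

/-- **(E2-v6) from the engine's ladder sums** (bundles `klPredsV8` / `klPredsV9`, `…SplitBundleV8`): same statement for `PairLadderStepAtV6`. -/
theorem pairLadderStepAtV6_of_ladderSums {G : GeoConsts} {P : SplitConsts} {Q : EngConsts} {β U μ : ℝ} {K : TrigPolyC4v} {n : ℕ}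
    (hn : 1 ≤ n) (hsplit : PairArrayAtV2 L M P Q β U μ K (n - 1)) (hD : 0 ≤ P.C_W + klLegKappa * Q.CR * P.Klam ^ 3)
    (hsmall : G.bhi * (2 * |U| + (P.C_W + klLegKappa * Q.CR * P.Klam ^ 3) * U ^ 2) ≤ 1 / 3)
    (hsup : ∀ Qm : TorusSite 2 L, IsPairClassAt L Qm n →
      ∃ (z : TorusSite 2 L → ℂ) (w : TorusSite 2 L → ℝ) (T : Matrix (TorusSite 2 L) (TorusSite 2 L) ℂ) (e₁ : ℝ),
        (∀ p, 0 ≤ w p) ∧ (∑ p, w p ≤ G.bhi) ∧ (∑ p, ‖z p‖ ≤ G.bhi) ∧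
        HasSum (fun i : ℕ => klPairArray L M β U μ K (n - 1) Qm *
          (-(Matrix.diagonal z * klPairArray L M β U μ K (n - 1) Qm)) ^ i) T ∧
        e₁ + 9 / 4 * (2 * |U| + (P.C_W + klLegKappa * Q.CR * P.Klam ^ 3) * U ^ 2) ^ 2 * ∑ p, ‖z p - (w p : ℂ)‖ ≤
          eremBar G P Q U β L (n - 1) ∧
        ∀ k ∈ klBall L μ K, ∀ k' ∈ klBall L μ K,
          ‖klPairAmplitude L M β U μ K n Qm k k' - T k k'‖ ≤
            drivePBar G P U (n - 1) + e₁ + thermalBar G P U β n +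
              legDressBarQ G P Q U n (legSliceCountT L β μ K n ![k', Qm - k', Qm - k, k])) :
    PairLadderStepAtV6 L M G P Q β U μ K n :=
  ⟨fun h0 => absurd h0 (by omega), fun _ => klpli_succ_conjunct L M (legSliceCountT L β μ K) hsplit hD hsmall hsup⟩

/-- **(E2-v5) from the engine's ladder sums** (gen-2 bundle `klPredsV7`, item stmt-HubbardSuperconductivity-19662, `…SplitLegStaging`): same
statement for `PairLadderStepAtV5` (leg count `legSliceCount L μ K n`). -/
theorem pairLadderStepAtV5_of_ladderSums {G : GeoConsts} {P : SplitConsts} {Q : EngConsts} {β U μ : ℝ} {K : TrigPolyC4v} {n : ℕ}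
    (hn : 1 ≤ n) (hsplit : PairArrayAtV2 L M P Q β U μ K (n - 1)) (hD : 0 ≤ P.C_W + klLegKappa * Q.CR * P.Klam ^ 3)
    (hsmall : G.bhi * (2 * |U| + (P.C_W + klLegKappa * Q.CR * P.Klam ^ 3) * U ^ 2) ≤ 1 / 3)
    (hsup : ∀ Qm : TorusSite 2 L, IsPairClassAt L Qm n →
      ∃ (z : TorusSite 2 L → ℂ) (w : TorusSite 2 L → ℝ) (T : Matrix (TorusSite 2 L) (TorusSite 2 L) ℂ) (e₁ : ℝ),
        (∀ p, 0 ≤ w p) ∧ (∑ p, w p ≤ G.bhi) ∧ (∑ p, ‖z p‖ ≤ G.bhi) ∧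
        HasSum (fun i : ℕ => klPairArray L M β U μ K (n - 1) Qm *
          (-(Matrix.diagonal z * klPairArray L M β U μ K (n - 1) Qm)) ^ i) T ∧
        e₁ + 9 / 4 * (2 * |U| + (P.C_W + klLegKappa * Q.CR * P.Klam ^ 3) * U ^ 2) ^ 2 * ∑ p, ‖z p - (w p : ℂ)‖ ≤
          eremBar G P Q U β L (n - 1) ∧
        ∀ k ∈ klBall L μ K, ∀ k' ∈ klBall L μ K,
          ‖klPairAmplitude L M β U μ K n Qm k k' - T k k'‖ ≤
            drivePBar G P U (n - 1) + e₁ + thermalBar G P U β n +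
              legDressBarQ G P Q U n (legSliceCount L μ K n ![k', Qm - k', Qm - k, k])) :
    PairLadderStepAtV5 L M G P Q β U μ K n :=
  ⟨fun h0 => absurd h0 (by omega), fun _ => klpli_succ_conjunct L M (legSliceCount L μ K) hsplit hD hsmall hsup⟩

end Model

end Summit.HubbardSuperconductivity.HubbardSuperconductivity.Theorems.KLRegimeSplit

end
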